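import Literature.Geometry.Lorentzian.CoordTensorCalculus
import HarnessLib

/-!
# The Laplacian of a contraction: `Δ⟨S, T⟩ = ⟨ΔS, T⟩ + 2⟨∇S, ∇T⟩ + ⟨S, ΔT⟩`

Rank-generic coordinate tensor calculus (`CoordTensorCalculus.lean`: metric components `G` on an
open set `V` (`IsMetricOn G V`), basis `b`, component fields `T : E → (α → ι) → ℝ`, covariant
derivative `tcov`, rough Laplacian `tlap = tr ∇²`, full contraction `tinner`, `tnormSq`). The file
`CoordTensorCalculus.lean` proves `Δ|T|² = 2⟨ΔT, T⟩ + 2|∇T|²` (`IsMetricOn.lapAt_tnormSq`); here we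
record its **polarisation**,

  `Δ⟨S, T⟩ = ⟨ΔS, T⟩ + 2⟨∇S, ∇T⟩ + ⟨S, ΔT⟩`   (`IsMetricOn.lapAt_tinner`),

`Δ` on the left the coordinate Laplace–Beltrami operator `lapAt` of the scalar `y ↦ ⟨S, T⟩(y)`
(Topping 2006, §2.1: `∇` is compatible with `⟨·,·⟩`, so `Δ⟨S,T⟩ = ⟨ΔS,T⟩ + 2⟨∇S,∇T⟩ + ⟨S,ΔT⟩`),
together with the elementary facts it needs: the locality and linearity of `lapAt`
(private copies of `lapAt_congr_of_eventuallyEq`, `lapAt_sub`, `lapAt_const_mul` of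
`CoordEntropyFormula.lean`, for `C^∞` functions on `V`), the additivity of the rough
Laplacian at points of `V` (`tlap_add_apply`, `tlap_sub_apply`) and the pointwise congruence of
`tinner`. It is the differential half of Derdziński's Weitzenböck formula for `W⁺`
(`½Δ|W⁺|² = ⟨ΔW⁺, W⁺⟩ + |∇W⁺|²` with `|W⁺|² = ⅛(⟨W, W⟩ + ⟨W, ⋆W⟩)`; Gursky–LeBrun 1999, (1.3)).
Everything is proved; no definition is introduced.

## References

* P. Topping, *Lectures on the Ricci flow*, LMS Lecture Note Series 325, CUP 2006, §2.1 (norms and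
  inner products of tensors, `Δ = tr ∇²`), §3.2, p. 37. [Topping2006]
* B. O'Neill, *Semi-Riemannian geometry*, Academic Press 1983, Ch. 2, Prop. 2.13; Ch. 3,
  Prop. 3.13, Def. 3.50. [ONeill1983]
* M. J. Gursky, C. LeBrun, Ann. Global Anal. Geom. 17 (1999) 315–328, §3, (1.3). [GurskyLebrun1999]
-/

noncomputable section

open Set Filter Module
open scoped Topology ContDiff

namespace Literature.Geometry.Lorentzian

namespace MetricCoord

variable {E : Type*} [NormedAddCommGroup E] [NormedSpace ℝ E]

/-! ### Locality and linearity of the coordinate Laplacian -/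

section LapAt

variable [FiniteDimensional ℝ E] (G : E → E →L[ℝ] E →L[ℝ] ℝ) {V : Set E} {x : E}

/-- `lapAt` only depends on the germ of the function (a private copy of the lemma of
`CoordEntropyFormula.lean`, which is not imported here). [folklore] -/
private theorem lapAt_congr_of_eventuallyEq' {f g : E → ℝ} (h : f =ᶠ[𝓝 x] g) : lapAt G f x = lapAt G g x := by
  unfold lapAt hessAt
  rw [h.fderiv_eq, h.fderiv.fderiv_eq]

variable {G}

omit [FiniteDimensional ℝ E] in
/-- A `C^∞` function on an open set has a differentiable derivative there. [folklore] -/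
private theorem differentiableAt_fderiv_of_contDiffOn (hV : IsOpen V) {f : E → ℝ}
    (hf : ContDiffOn ℝ ∞ f V) (hx : x ∈ V) : DifferentiableAt ℝ (fderiv ℝ f) x :=
  ((hf.fderiv_of_isOpen (m := ∞) hV (by simp)).contDiffAt (hV.mem_nhds hx)).differentiableAt
    (by simp)

variable (G) in
/-- `Δ(f − g) = Δf − Δg` for `C^∞` functions on an open set (private variant of
`CoordEntropyFormula.lapAt_sub`). [cite: ONeill1983, Ch. 3, Def. 3.50] -/
private theorem lapAt_sub' (hV : IsOpen V) {f g : E → ℝ} (hf : ContDiffOn ℝ ∞ f V) (hg : ContDiffOn ℝ ∞ g V)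
    (hx : x ∈ V) : lapAt G (f - g) x = lapAt G f x - lapAt G g x := by
  have hfd : ∀ y ∈ V, DifferentiableAt ℝ f y := fun y hy ↦
    (hf.contDiffAt (hV.mem_nhds hy)).differentiableAt (by simp)
  have hgd : ∀ y ∈ V, DifferentiableAt ℝ g y := fun y hy ↦
    (hg.contDiffAt (hV.mem_nhds hy)).differentiableAt (by simp)
  have hev : fderiv ℝ (f - g) =ᶠ[𝓝 x] fun y ↦ fderiv ℝ f y - fderiv ℝ g y :=
    Filter.eventually_of_mem (hV.mem_nhds hx) fun y hy ↦ fderiv_sub (hfd y hy) (hgd y hy)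
  unfold lapAt hessAt
  rw [hev.fderiv_eq, fderiv_fun_sub (differentiableAt_fderiv_of_contDiffOn hV hf hx)
    (differentiableAt_fderiv_of_contDiffOn hV hg hx), fderiv_sub (hfd x hx) (hgd x hx),
    ← mtrAt_sub]
  congr 1
  ext Y Z
  simp only [_root_.sub_apply, ContinuousLinearMap.comp_apply, ContinuousLinearMap.compL_apply]
  abel

variable (G) in
/-- `Δ(c f) = c Δf` for a `C^∞` function on an open set (private variant of
`CoordEntropyFormula.lapAt_const_mul`). [cite: ONeill1983, Ch. 3, Def. 3.50] -/
private theorem lapAt_const_mul' (hV : IsOpen V) {f : E → ℝ} (hf : ContDiffOn ℝ ∞ f V) (hx : x ∈ V) (c : ℝ) :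
    lapAt G (fun y ↦ c * f y) x = c * lapAt G f x := by
  have hfd : ∀ y ∈ V, DifferentiableAt ℝ f y := fun y hy ↦
    (hf.contDiffAt (hV.mem_nhds hy)).differentiableAt (by simp)
  have hev : fderiv ℝ (fun y ↦ c * f y) =ᶠ[𝓝 x] fun y ↦ c • fderiv ℝ f y :=
    Filter.eventually_of_mem (hV.mem_nhds hx) fun y hy ↦ fderiv_const_mul (hfd y hy) c
  unfold lapAt hessAt
  rw [hev.fderiv_eq, fderiv_fun_const_smul (differentiableAt_fderiv_of_contDiffOn hV hf hx),
    fderiv_const_mul (hfd x hx), ← mtrAt_smul]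
  congr 1
  ext Y Z
  simp only [_root_.sub_apply, ContinuousLinearMap.comp_apply, ContinuousLinearMap.compL_apply,
    _root_.smul_apply, smul_eq_mul, mul_sub]

end LapAt

/-! ### Additivity of the rough Laplacian and pointwise congruence of contractions -/

section TLap

variable {ι : Type*} [Fintype ι] {G : E → E →L[ℝ] E →L[ℝ] ℝ} {b : Basis ι ℝ E} {α : Type*}
  [Fintype α] [DecidableEq α] {V : Set E} {x : E} [CompleteSpace E] [FiniteDimensional ℝ E]

/-- `Δ(S + T) = ΔS + ΔT` at points of `V`. [cite: Topping2006, §2.1] -/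
theorem IsMetricOn.tlap_add_apply (hG : IsMetricOn G V) {S T : E → (α → ι) → ℝ}
    (hS : TSmoothOn S V) (hT : TSmoothOn T V) (hx : x ∈ V) (I : α → ι) :
    tlap G b (S + T) x I = tlap G b S x I + tlap G b T x I := by
  simp only [tlap_apply]
  rw [← Finset.sum_add_distrib]
  refine Finset.sum_congr rfl fun j _ ↦ ?_
  rw [← Finset.sum_add_distrib]
  refine Finset.sum_congr rfl fun k _ ↦ ?_
  have h1 : tcov G b (tcov G b (S + T)) x (ocons j (ocons k I)) =
      tcov G b (tcov G b S + tcov G b T) x (ocons j (ocons k I)) :=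
    tcov_congr hG.isOpen (fun y hy J ↦ by simp only [Pi.add_apply, tcov_add_apply hG.isOpen hS hT hy])
      hx _
  rw [h1, tcov_add_apply hG.isOpen (hG.tsmoothOn_tcov hS) (hG.tsmoothOn_tcov hT) hx]
  ring

/-- `Δ(S − T) = ΔS − ΔT` at points of `V`. [cite: Topping2006, §2.1] -/
theorem IsMetricOn.tlap_sub_apply (hG : IsMetricOn G V) {S T : E → (α → ι) → ℝ}
    (hS : TSmoothOn S V) (hT : TSmoothOn T V) (hx : x ∈ V) (I : α → ι) :
    tlap G b (S - T) x I = tlap G b S x I - tlap G b T x I := by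
  simp only [tlap_apply]
  rw [← Finset.sum_sub_distrib]
  refine Finset.sum_congr rfl fun j _ ↦ ?_
  rw [← Finset.sum_sub_distrib]
  refine Finset.sum_congr rfl fun k _ ↦ ?_
  have h1 : tcov G b (tcov G b (S - T)) x (ocons j (ocons k I)) =
      tcov G b (tcov G b S - tcov G b T) x (ocons j (ocons k I)) :=
    tcov_congr hG.isOpen (fun y hy J ↦ by simp only [Pi.sub_apply, tcov_sub_apply hG.isOpen hS hT hy])
      hx _
  rw [h1, tcov_sub_apply hG.isOpen (hG.tsmoothOn_tcov hS) (hG.tsmoothOn_tcov hT) hx]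
  ring

omit [CompleteSpace E] in
/-- `⟨S, T⟩(x)` only depends on the values of the fields at `x`. [folklore] -/
theorem tinner_congr_apply {S S' T T' : E → (α → ι) → ℝ} (hS : ∀ I, S x I = S' x I)
    (hT : ∀ I, T x I = T' x I) : tinner G b S T x = tinner G b S' T' x := by
  simp only [tinner_apply, hS, hT]

omit [CompleteSpace E] in
/-- **Polarisation**: `⟨S, T⟩ = ¼(|S + T|² − |S − T|²)` (symmetric `g⁻¹`). [folklore] -/
theorem tinner_eq_polar (hg : ∀ i j, ginv G b x i j = ginv G b x j i) (S T : E → (α → ι) → ℝ) :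
    tinner G b S T x = (1 / 4 : ℝ) * (tnormSq G b (S + T) x - tnormSq G b (S - T) x) := by
  rw [tnormSq_eq, tnormSq_eq, tinner_add_left, tinner_add_right, tinner_add_right,
    tinner_sub_left, tinner_sub_right, tinner_sub_right, tinner_comm hg T S]
  ring

/-- **`Δ⟨S, T⟩ = ⟨ΔS, T⟩ + 2⟨∇S, ∇T⟩ + ⟨S, ΔT⟩`** — the polarisation of
`Δ|T|² = 2⟨ΔT, T⟩ + 2|∇T|²` (`IsMetricOn.lapAt_tnormSq`), `Δ` on the left the coordinate
Laplace–Beltrami operator of the scalar `⟨S, T⟩`, on the right the rough Laplacian `tr ∇²`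
(Topping 2006, §2.1; O'Neill 1983, Ch. 3, Prop. 3.13: `∇` is compatible with contractions).
[cite: Topping2006, §2.1 and §3.2 (p. 37)] [cite: ONeill1983, Ch. 3, Prop. 3.13] -/
theorem IsMetricOn.lapAt_tinner (hG : IsMetricOn G V) {S T : E → (α → ι) → ℝ}
    (hS : TSmoothOn S V) (hT : TSmoothOn T V) (hx : x ∈ V) :
    lapAt G (tinner G b S T) x =
      tinner G b (tlap G b S) T x + 2 * tinner G b (tcov G b S) (tcov G b T) x +
        tinner G b S (tlap G b T) x := by
  have hgs : ∀ y ∈ V, ∀ p q, ginv G b y p q = ginv G b y q p :=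
    fun y hy p q ↦ ginv_comm b (hG.isInvertible y hy) (hG.symm y hy) p q
  -- polarise the scalar on `V`
  have hev : tinner G b S T =ᶠ[𝓝 x]
      fun y ↦ (1 / 4 : ℝ) * (tnormSq G b (S + T) - tnormSq G b (S - T)) y :=
    Filter.eventually_of_mem (hG.isOpen.mem_nhds hx) fun y hy ↦ by
      show tinner G b S T y = (1 / 4 : ℝ) * ((tnormSq G b (S + T) - tnormSq G b (S - T)) y)
      rw [Pi.sub_apply, tinner_eq_polar (hgs y hy) S T]
  have hP : ContDiffOn ℝ ∞ (tnormSq G b (S + T)) V := hG.contDiffOn_tnormSq (hS.add hT)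
  have hM : ContDiffOn ℝ ∞ (tnormSq G b (S - T)) V := hG.contDiffOn_tnormSq (hS.sub hT)
  rw [lapAt_congr_of_eventuallyEq' G hev,
    lapAt_const_mul' G hG.isOpen (f := tnormSq G b (S + T) - tnormSq G b (S - T)) (hP.sub hM) hx,
    lapAt_sub' G hG.isOpen hP hM hx, hG.lapAt_tnormSq (hS.add hT) hx, hG.lapAt_tnormSq (hS.sub hT) hx]
  -- expand the right-hand sides at `x`
  have e1 : tinner G b (tlap G b (S + T)) (S + T) x =
      tinner G b (tlap G b S + tlap G b T) (S + T) x :=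
    tinner_congr_apply (fun I ↦ by simp only [Pi.add_apply, hG.tlap_add_apply hS hT hx]) fun _ ↦ rfl
  have e2 : tinner G b (tlap G b (S - T)) (S - T) x =
      tinner G b (tlap G b S - tlap G b T) (S - T) x :=
    tinner_congr_apply (fun I ↦ by simp only [Pi.sub_apply, hG.tlap_sub_apply hS hT hx]) fun _ ↦ rfl
  have e3 : tnormSq G b (tcov G b (S + T)) x = tnormSq G b (tcov G b S + tcov G b T) x :=
    tinner_congr_apply (fun J ↦ by simp only [Pi.add_apply, tcov_add_apply hG.isOpen hS hT hx])
      fun J ↦ by simp only [Pi.add_apply, tcov_add_apply hG.isOpen hS hT hx]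
  have e4 : tnormSq G b (tcov G b (S - T)) x = tnormSq G b (tcov G b S - tcov G b T) x :=
    tinner_congr_apply (fun J ↦ by simp only [Pi.sub_apply, tcov_sub_apply hG.isOpen hS hT hx])
      fun J ↦ by simp only [Pi.sub_apply, tcov_sub_apply hG.isOpen hS hT hx]
  rw [e1, e2, e3, e4]
  simp only [tnormSq_eq, tinner_add_left, tinner_add_right, tinner_sub_left, tinner_sub_right,
    tinner_comm (hgs x hx) (tlap G b T) S, tinner_comm (hgs x hx) (tcov G b T) (tcov G b S)]
  ring

end TLap

end MetricCoord

end Literature.Geometry.Lorentzian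

end
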